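/-
Copyright (c) 2026. All rights reserved.
Released under Apache 2.0 license as described in the file LICENSE.
-/
import Mathlib
import Summits.MatrixMultiplication.Statement
import Summits.MatrixMultiplication.MatrixMultiplication.Theorems.GraphEquationsDegreeLadder
import Summits.MatrixMultiplication.MatrixMultiplication.Theorems.GraphEquationsInitialIdeal
import Summits.MatrixMultiplication.MatrixMultiplication.Theorems.GraphEquationsIsolationOpen
import Summits.MatrixMultiplication.MatrixMultiplication.Theorems.GraphEquationsPurification

/-!
# The bridge from the DEGREE ladder to the ORDER ladder (`GraphEquations`, kernel M70, decomp-mm-lens-5 g42)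

Supports `MultiplicityReduction` (stmt-MatrixMultiplication-27806).  Route-neutral; `closes` unchanged.

M67 (`GraphEquationsDegreeLadder`) cut the crux by TEST DEGREE: rungs
`EquationsForceMultiplicationDeg D` (EFM_D; `D ≤ 3` theorems, `D ≥ 4` open).  The line «purisplit»
cut `Purification` by ISOLATION ORDER: `EqAdmissibleIdealIso β K → EqAdmissiblePure β'`, whose rung
`K = 2` is a THEOREM (`boundedOrderPurification_two`, `GraphEquationsIsolationOpen`), and pure systems
give `ω ≤ β'` unconditionally (`EqAdmissiblePure.omega_le`, M12).

This module joins the two ladders.  The single algebraic statement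

  `DegreeBoundsIsoOrder D K` — every correct system (`n ≥ 1`) whose tests have total degree `≤ D`
  has its test ideal initially isolated to order `K` over SOME base `(A₀, B₀)`

("no order-`K` masking in degree `D`"; pure commutative algebra of the graph ideal `(f_q)_q`, no
cost, no asymptotics) transfers degree rungs to order rungs:

* `eqAdmissibleIdealIso_of_degreeBoundsIsoOrder : DegreeBoundsIsoOrder D K → EqAdmissibleDeg D β →
  EqAdmissibleIdealIso β K`;
* **`efmDeg_of_degreeBoundsIsoOrder_two : DegreeBoundsIsoOrder D 2 → EquationsForceMultiplicationDeg D`**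
  — so `DegreeBoundsIsoOrder 4 2` (resp. `5 2`) is EXACTLY what stands between the tree and
  `[ω₄ = ω]` (resp. `[ω₅ = ω]`): the order-`2` purification engine is already proved;
* `efmDeg_all_of_degreeBoundsIsoOrder_two`: if no degree masks at order `2`, every rung EFM_D holds and
  the crux is `BoundedDegreeReduction` alone (`multiplicityReduction_of_bdr_of_degreeBoundsIsoOrder_two`);
* monotonicity (`DegreeBoundsIsoOrder.anti_deg`, `.mono_ord`).

UPPER ANATOMY (why `K` must grow with `D`): tests in `I^e` are never ideal-initially-isolated to
order `< e` (`EqSystem.not_idealInitIsolatedAt_of_tests_mem_pow`, M14a), and `{f_q^e}` has degree `2e`;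
so `DegreeBoundsIsoOrder (2e) K` needs `K ≥ e`.  The natural conjecture for the next generation is
`DegreeBoundsIsoOrder (2K+1) K` ("order `≥ K+1` costs degree `≥ 2K+2`, and degree `≤ 2K+1` cannot
rescue an order-`K` masking"), whose case `K = 2` gives `[ω₅ = ω]` by this file.

Sources: [BurgisserClausenShokrollahi1997, Problem 16.3]; [Strassen1973]; T. Mora, EUROCAM 1982
(tangent cones).  No `sorry`, no new engines.
-/

set_option linter.dupNamespace false

noncomputable section

namespace Summit.MatrixMultiplication.MatrixMultiplication.Theorems.GraphEquations

open MvPolynomial Literature.Computability.AlgebraicComplexity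

/-- **No order-`K` masking in degree `D`:** every correct system over `n ≥ 1` whose tests have total
degree `≤ D` has its test ideal initially isolated to order `K` over some base. -/
def DegreeBoundsIsoOrder (D K : ℕ) : Prop :=
  ∀ n : ℕ, 1 ≤ n → ∀ E : EqSystem n, E.Correct → E.IsDegLe D → ∃ y, E.IdealInitIsolatedAt K y

/-- Antitone in the degree. -/
theorem DegreeBoundsIsoOrder.anti_deg {D D' K : ℕ} (h : DegreeBoundsIsoOrder D' K) (hDD' : D ≤ D') :
    DegreeBoundsIsoOrder D K :=
  fun n hn E hE hD => h n hn E hE (hD.mono hDD')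

/-- **Degree rungs become order rungs:** `DegreeBoundsIsoOrder D K` turns degree-`D` admissibility
into order-`K` ideal-isolated admissibility at the same exponent. -/
theorem eqAdmissibleIdealIso_of_degreeBoundsIsoOrder {D K : ℕ} (h : DegreeBoundsIsoOrder D K)
    {β : ℝ} (hA : EqAdmissibleDeg D β) : EqAdmissibleIdealIso β K := by
  obtain ⟨c, hc⟩ := hA
  refine ⟨c, fun n hn => ?_⟩
  obtain ⟨E, hE, hD, hcost⟩ := hc n hn
  exact ⟨E, hE, h n hn E hE hD, hcost⟩

/-- **EFM_D from no order-`2` masking in degree `D`** — the order-`2` purification engine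
(`boundedOrderPurification_two`) and `EqAdmissiblePure.omega_le` are theorems. -/
theorem efmDeg_of_degreeBoundsIsoOrder_two {D : ℕ} (h : DegreeBoundsIsoOrder D 2) :
    EquationsForceMultiplicationDeg D := by
  intro β hβ hA
  have hI : EqAdmissibleIdealIso β 2 := eqAdmissibleIdealIso_of_degreeBoundsIsoOrder h hA
  refine le_of_forall_gt_imp_ge_of_dense fun β' hβ' => ?_
  exact (boundedOrderPurification_two β hβ hI β' hβ').omega_le

/-- If no degree masks at order `2`, EVERY rung of the degree ladder holds. -/
theorem efmDeg_all_of_degreeBoundsIsoOrder_two (h : ∀ D, DegreeBoundsIsoOrder D 2) (D : ℕ) :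
    EquationsForceMultiplicationDeg D :=
  efmDeg_of_degreeBoundsIsoOrder_two (h D)

/-- … and then the crux `MultiplicityReduction` is `BoundedDegreeReduction` alone (M67's split). -/
theorem multiplicityReduction_of_bdr_of_degreeBoundsIsoOrder_two (h : ∀ D, DegreeBoundsIsoOrder D 2)
    (hB : BoundedDegreeReduction) : MultiplicityReduction :=
  multiplicityReduction_of_degree_ladder (efmDeg_all_of_degreeBoundsIsoOrder_two h) hB

/-- **UPPER ANATOMY.**  A correct system over `n ≥ 1` whose tests lie in `I^e` with `K < e` is
ideal-initially-isolated to order `K` over NO base (M14a); hence a degree bound `D` can force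
isolation order `K` only if degree `≤ D` excludes `I^(K+1)`-systems — `{f_q^(K+1)}` has degree
`2K+2`, so `DegreeBoundsIsoOrder D K` with `D ≥ 2K+2` fails as soon as such a system is typed. -/
theorem not_exists_idealInitIsolatedAt_of_tests_mem_pow {n : ℕ} (hn : 1 ≤ n) {E : EqSystem n}
    {K e : ℕ} (hK : K < e)
    (hE : ∀ o : Fin E.tests.length, E.testPoly (E.tests.get o) ∈ graphIdeal n ^ e) :
    ¬ ∃ y, E.IdealInitIsolatedAt K y :=
  fun ⟨y, hy⟩ => EqSystem.not_idealInitIsolatedAt_of_tests_mem_pow hn hK hE y hy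

/-- The degree-to-order bridge in one line: no order-`2` masking in degree `D` and tests of degree
`≤ D` at cost `O(n^β)`, `β ≥ 2`, give `ω ≤ β`. -/
theorem omega_le_of_degreeBoundsIsoOrder_two {D : ℕ} (h : DegreeBoundsIsoOrder D 2) {β : ℝ}
    (hβ : 2 ≤ β) (hA : EqAdmissibleDeg D β) : omega ℂ ≤ β :=
  efmDeg_of_degreeBoundsIsoOrder_two h β hβ hA

end Summit.MatrixMultiplication.MatrixMultiplication.Theorems.GraphEquations
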